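import Summits.BirchSwinnertonDyer.Rank1Residual.AdditivePotMult.PotMultRankZeroUpperHalfOfExactLeadingTermAnyOdd
import Summits.BirchSwinnertonDyer.Rank1Residual.Additive.GordRankZeroUpperHalfOfExactLeadingTerm
import Summits.BirchSwinnertonDyer.Rank1Residual.Additive.GordRankZeroEndsOfControl
import Summits.BirchSwinnertonDyer.Rank1Residual.Additive.GordRankZeroUpperHalfOfExactLeadingTermFiveLe
import Summits.BirchSwinnertonDyer.Rank1Residual.Additive.N10LowerHalfResidue
import Summits.BirchSwinnertonDyer.Rank1Residual.Additive.X4RankZeroCoveredLocusNoLemma20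
import Summits.BirchSwinnertonDyer.Rank1Residual.Additive.X3SharpResidueThm16
import Summits.BirchSwinnertonDyer.Rank1Residual.X2.ClassClosureEntireFree
import HarnessLib

/-!
# The n1011 class ENDs of record WITHOUT the modularity binder `hmod : hasEntireLFunction_rat` — derived
# in-file from the parametrisation datum `hmodD : nonempty_modularParametrizationData` each of them
# already displays (cell `b2b-bsdres`, team n1011, ROW T-ENTFREE, seat p10 GEN 10)

HONEST FRAMING (cell `b2b-bsdres`, run/shared/lean/b2b/bsd-rank1-residual/, verbatim in every
file): the goal of the cell is to DELETE the COMBINATION-SHAPED residual classes of the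
Birch–Swinnerton-Dyer formula for ALL analytic-rank `≤ 1` elliptic curves over `ℚ` — "full BSD
formula for every rank `≤ 1` curve in class `C`" assembled STRICTLY from published theorems — so
that the rank-`≤ 1` remainder becomes exactly the CONSTRUCTION-SHAPED classes, which are TYPED
(missing-input `Prop`s), NOT attempted. This is not "finishing BSD". Team n1011 (RESIDUAL-MAP §I N11 /
N10): research route; END-twin theorems only — no definition, no named fact, no `sorry`; nothing booked;
no residual-map mark / label / count moved; no row closed — the twins RE-KEY existing class ENDs on a
strict sub-list of their displayed named facts. NOTHING of r2's / p06's / p07's / cc-typer-2's /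
additive-p4's / additive-p2's / eisenstein-p2's is edited: every declaration below is NEW and consumes
theirs BY NAME.

## What and why

Every rank-`0` class END of record of team n1011 displays BOTH `hmod : hasEntireLFunction_rat` (A19:
`L(E, s)` is entire for every `E/ℚ`) AND `hmodD : nonempty_modularParametrizationData` (BCDT: a
modular parametrisation datum for every globally minimal `E/ℚ`). The first FOLLOWS from the second by
theorems of the tree — the observation of the X2 cell (`b2b-bsdres-eisenstein-p2` GEN 29,
`Summits/…/X2/ClassClosureEntireFree.lean`,
`X2.ClassClosureEntireFree.hasEntireLFunction_rat_of_nonempty_modularParametrizationData`, consumed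
here BY NAME; it composes `exists_isNewformOf_of_nonempty_modularParametrizationData` (a datum for the
minimal model gives the newform of `E`, BCDT p. 845 (6) ⇒ (2)) with
`hasEntireLFunction_rat_of_exists_isNewformOf` (Diamond–Shurman Thm. 5.10.2 / 8.8.3: `L(E, s) = L(f, s)`
entire)).
A displayed-fact census of the `BSDp` / `Missing*At` ENDs under `Rank1Residual` (p10 GEN 10,
`HOME/b2b-bsdres-n1011-p10/g10/census/FACT-BRIDGES.tsv`) finds the redundant pair {hmod, hmodD} on
1 096 END-shaped theorems; this file re-keys the n1011 ENDs OF RECORD (and cc-typer-2's N10 class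
ENDs), binder diff EXACTLY {`hmod`} ↦ ∅ (plus, where displayed, the tree-proved `hL20` / `hPal` fed by
their `_holds`), NOTHING added, conclusions and every other binder identical:

* (A) route 2's (M)@3 END (`…_pow_le_card_selmerGroup_exact`, T-DEL98X FILE 1): `…_entireFree`
  {hK, hDelX, hGZK, hmodD, h414} = 5 (was 6);
* (B) the Gord@3 `B = 0` rows' END (p06 T-CTL-END `…_pow_le_card_selmerGroup_of_prop414`): 5 ↦ 4;
* (C) the Gord@3 `437742q1` END (`…_of_nonAnomalous_noDel98`, T-DEL98X FILE 2b): 6 ↦ 5;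
* (D) route 2's (M) `p ≥ 5` END (`…_of_firstUnitIndex_of_budget_exact` and its Ш-door form, FILE 3): 5 ↦ 4
  / 6 ↦ 5;
* (E) route 2's Gord_e2 `p ≥ 5` END (`ClassX4Gord.…_of_budget_of_nonAnomalous`, p10 GEN 2 :144):
  −hmod, −hPal ⇒ 7 ↦ 5 {hK, hDel98, hDel, hGZK, hmodD}; (E′) its T-DEL98X-5 successor `…_noDel98`
  (the END of record after p325814): 5 ↦ 4 {hK, hDel, hGZK, hmodD};
* (F) cc-typer-2's N10 CLASS ENDs `N10.bsdp_rankZero_classX4M_of_lowerHalfM_of_surj` (−hmod, −hL20 via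
  p14's `…_noL20` chain: 6 ↦ 4), `…classX4GordTwo…` (5 ↦ 4), `…classX4_covered…` (−hmod, −hL20: 7 ↦ 5),
  `…classX3…_of_thm16` (T-WU16X: 5 ↦ 4);
* (G) the X3 @ 3 `W = 2` descent END (`…_of_casselsTate_of_selmerGroup_ne_bot_of_thm16`): 6 ↦ 5.

What is NOT claimed: no row closes; A19 stays a registered fact and the input of every END that does
not display `hmodD`; nothing is booked. Axioms standard.

References: C. Breuil, B. Conrad, F. Diamond, R. Taylor, JAMS 14 (2001) Thm. A and p. 845 (6) ⇒ (2)
[BCDTJAMS2001]; F. Diamond, J. Shurman, GTM 228 (2005) Thm. 5.10.2, Thm. 8.8.3 [DiamondShurman2005];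
cells/n1011/PLAN.md §K.2; names line cells/n1011/INBOX.md 2026-08-22T10:04Z.
-/

noncomputable section

open scoped Classical MatrixGroups ModularForm NumberField

open CongruenceSubgroup WeierstrassCurve NumberField Literature.NumberTheory.EllipticCurves
  Literature.NumberTheory.EllipticCurves.ModularForms
  Literature.NumberTheory.EllipticCurves.Rank1Residual
  Literature.NumberTheory.EllipticCurves.Rank1Residual.Typed
  IsDedekindDomain Rat.HeightOneSpectrum

open Summit.BirchSwinnertonDyer.Rank1Residual.X2.ClassClosureEntireFree
  (hasEntireLFunction_rat_of_nonempty_modularParametrizationData)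

/-! ### §1 (A), (D): route 2's (M) ENDs of record, `p = 3` and any odd `p` -/

namespace Summit.BirchSwinnertonDyer.Rank1Residual.AdditivePotMult

open Additive Additive.CensusQ6

variable {W : WeierstrassCurve ℚ} [W.IsElliptic] [W.IsGloballyMinimal] {p : ℕ} [hp : Fact p.Prime]

/-- **(A) ROUTE 2's (M) END OF RECORD at `3`, modularity binder OUT**: X4(M) ∧ surj(3) ∧ `r_an = 0`,
`BSD(E,3)` ⟸ the odd record at index `b` + `3 ^ b ≤ #Sel⁽³⁾(E/ℚ)` — T-DEL98X FILE 1's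
`…_of_firstUnitIndex_of_pow_le_card_selmerGroup_exact` with binder diff EXACTLY {`hmod`} ↦ ∅, NOTHING
added: displayed named facts {hK, hDelX, hGZK, hmodD, h414} = 5. [cite: GreenbergLNM1716, Prop. 4.14 (p. 114)]
[cite: Kato2004Asterisque, Thm. 17.4 (3) (p. 273)] [cite: Delbourgo1998, Prop. 4 (p. 144) and §2.2 Lemma (ii) (p. 139)]
[cite: BCDTJAMS2001, Theorem A] [cite: Miller2011LMS, §1 and Def. 1.1] -/
theorem ClassX4M.bsdp_three_rankZero_of_surj_of_katoHalf_of_firstUnitIndex_of_pow_le_card_selmerGroup_exact_entireFree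
    [Fact (Nat.Prime 3)]
    (hK : Wuthrich2014.kato_halfEigenCharIdeal_dvd_cyclotomicPrime_of_surjective)
    (hDelX : Delbourgo1998.prop4_rankZero_constantCoeff_eq_unit_mul_of_potMult)
    (hGZK : rank_eq_analyticRank_of_analyticRank_le_one)
    (hmodD : nonempty_modularParametrizationData)
    (h414 : Greenberg1999.prop414_noFiniteSubmodule_of_not_dvd_torsionOrder)
    (hX : ClassX4M W 3) (hsurj : Surj W 3) (hr : W.analyticRank = 0) {b : ℕ}
    (hrec : MultOddFirstUnitIndexAt W 3 b) (hSel : 3 ^ b ≤ Nat.card (selmerGroup W (3 : ℤ))) :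
    BSDp W 3 :=
  hX.bsdp_three_rankZero_of_surj_of_katoHalf_of_firstUnitIndex_of_pow_le_card_selmerGroup_exact hK
    hDelX hGZK (hasEntireLFunction_rat_of_nonempty_modularParametrizationData hmodD) hmodD h414 hsurj hr hrec hSel

/-- **(D) ROUTE 2's (M) END at `p ≥ 5` (p07's general-`p` END re-keyed), modularity binder OUT**:
X4(M) ∧ surj(p) ∧ `r_an = 0`, ANY odd `p`, `BSD(E,p)` ⟸ the record of the parity of `(p−1)/2` at
index `b` + the budget — T-DEL98X FILE 3's `…_of_firstUnitIndex_of_budget_exact` with `{hmod}` ↦ ∅: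
{hK, hDelX, hGZK, hmodD} = 4. [cite: Kato2004Asterisque, Thm. 17.4 (3) (p. 273)]
[cite: Delbourgo1998, Prop. 4 (p. 144) and §2.2 Lemma (ii) (p. 139)] [cite: BCDTJAMS2001, Theorem A]
[cite: EmertonPollackWeston2006, Cor. 3.2.5 and Thm. 3.1.1 (source of the typed input)] [cite: Miller2011LMS, §1 and Def. 1.1] -/
theorem ClassX4M.bsdp_rankZero_of_surj_of_katoHalf_of_firstUnitIndex_of_budget_exact_entireFree
    (hK : Wuthrich2014.kato_halfEigenCharIdeal_dvd_cyclotomicPrime_of_surjective)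
    (hDelX : Delbourgo1998.prop4_rankZero_constantCoeff_eq_unit_mul_of_potMult)
    (hGZK : rank_eq_analyticRank_of_analyticRank_le_one)
    (hmodD : nonempty_modularParametrizationData)
    (hX : ClassX4M W p) (hsurj : Surj W p) (hr : W.analyticRank = 0) {b : ℕ}
    (hrec : (p % 4 = 1 → MultFirstUnitIndexAt W p b) ∧ (p % 4 = 3 → MultOddFirstUnitIndexAt W p b))
    (hbud : BudgetLeLambdaAt p W b) : BSDp W p :=
  hX.bsdp_rankZero_of_surj_of_katoHalf_of_firstUnitIndex_of_budget_exact hK hDelX hGZK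
    (hasEntireLFunction_rat_of_nonempty_modularParametrizationData hmodD) hmodD hsurj hr hrec hbud

/-- **(D′) the Ш-door form at `p ≥ 5`, modularity binder OUT**: {hK, hDelX, hGZK, hmodD, h414} = 5.
[cite: GreenbergLNM1716, Prop. 4.14 (p. 114)] [cite: Kato2004Asterisque, Thm. 17.4 (3) (p. 273)]
[cite: Delbourgo1998, Prop. 4 (p. 144) and §2.2 Lemma (ii) (p. 139)] [cite: BCDTJAMS2001, Theorem A]
[cite: Miller2011LMS, §1 and Def. 1.1] -/
theorem ClassX4M.bsdp_rankZero_of_surj_of_katoHalf_of_firstUnitIndex_of_pow_le_card_selmerGroup_exact_entireFree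
    (hK : Wuthrich2014.kato_halfEigenCharIdeal_dvd_cyclotomicPrime_of_surjective)
    (hDelX : Delbourgo1998.prop4_rankZero_constantCoeff_eq_unit_mul_of_potMult)
    (hGZK : rank_eq_analyticRank_of_analyticRank_le_one)
    (hmodD : nonempty_modularParametrizationData)
    (h414 : Greenberg1999.prop414_noFiniteSubmodule_of_not_dvd_torsionOrder)
    (hX : ClassX4M W p) (hsurj : Surj W p) (hr : W.analyticRank = 0) {b : ℕ}
    (hrec : (p % 4 = 1 → MultFirstUnitIndexAt W p b) ∧ (p % 4 = 3 → MultOddFirstUnitIndexAt W p b))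
    (hSel : p ^ b ≤ Nat.card (selmerGroup W (p : ℤ))) : BSDp W p :=
  hX.bsdp_rankZero_of_surj_of_katoHalf_of_firstUnitIndex_of_pow_le_card_selmerGroup_exact hK hDelX hGZK
    (hasEntireLFunction_rat_of_nonempty_modularParametrizationData hmodD) hmodD h414 hsurj hr hrec hSel

end Summit.BirchSwinnertonDyer.Rank1Residual.AdditivePotMult

/-! ### §2 (B), (C), (E): the X4♯(G-ord) ENDs of record, `p = 3` and `p ≥ 5` -/

namespace Summit.BirchSwinnertonDyer.Rank1Residual.Additive

open AdditivePotMult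

section Gord

variable {W : WeierstrassCurve ℚ} [W.IsElliptic] [W.IsGloballyMinimal] {p : ℕ} [hp : Fact p.Prime]

/-- **(B) the Gord@3 `B = 0` rows' END OF RECORD (p06 T-CTL-END §3), modularity binder OUT**:
X4♯(G-ord) at `3` ∧ surj(3), `r_an = 0`, `3 ∤ Tam(E)`: `BSD(E,3)` ⟸ ONE unit coefficient at index
`b` + `3 ^ b ≤ #Sel⁽³⁾(E/ℚ)` — `…_of_pow_le_card_selmerGroup_of_prop414` with `{hmod}` ↦ ∅, NOTHING
added: {hK, hGZK, hmodD, h414} = 4. [cite: GreenbergLNM1716, Prop. 4.14 (p. 114)]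
[cite: Kato2004Asterisque, Thm. 17.4 (3) (p. 273)] [cite: BCDTJAMS2001, Theorem A] [cite: Miller2011LMS, §1 and Def. 1.1] -/
theorem ClassX4Gord.bsdp_three_rankZero_of_katoHalf_of_coeffCert_of_pow_le_card_selmerGroup_of_prop414_entireFree
    [Fact (Nat.Prime 3)]
    (hK : Wuthrich2014.kato_halfEigenCharIdeal_dvd_cyclotomicPrime_of_surjective)
    (hGZK : rank_eq_analyticRank_of_analyticRank_le_one)
    (hmodD : nonempty_modularParametrizationData)
    (h414 : Greenberg1999.prop414_noFiniteSubmodule_of_not_dvd_torsionOrder)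
    (hX : ClassX4Gord W 3) (hsurj : Surj W 3) (hr : W.analyticRank = 0)
    {b : ℕ} (hcert : BranchUnitCoeffAt W 3 b) (hSel : 3 ^ b ≤ Nat.card (selmerGroup W (3 : ℤ)))
    (S : Finset (HeightOneSpectrum (𝓞 ℚ)))
    (hgood : ∀ v ∉ S, ((3 : ℕ) : 𝓞 ℚ) ∉ v.asIdeal ∧ W.HasGoodReductionAt v)
    (hB : ¬ 3 ∣ W.tamagawaProduct) : BSDp W 3 :=
  ClassX4Gord.bsdp_three_rankZero_of_katoHalf_of_coeffCert_of_pow_le_card_selmerGroup_of_prop414 hK hGZK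
    (hasEntireLFunction_rat_of_nonempty_modularParametrizationData hmodD) hmodD h414 hX hsurj hr hcert hSel S hgood hB

/-- **(C) the Gord@3 END serving `437742q1` (T-DEL98X FILE 2b), modularity binder OUT**: X4♯(G-ord) at
`3` ∧ surj(3), `r_an = 0`, non-CM, non-anomalous: `BSD(E,3)` ⟸ ONE unit coefficient at index `b` +
`3 ^ b ≤ #Sel⁽³⁾(E/ℚ)` — `…_of_nonAnomalous_noDel98` with `{hmod}` ↦ ∅: {hK, hDel3, hGZK, hmodD, h414} = 5.
[cite: GreenbergLNM1716, Prop. 4.14 (p. 114)] [cite: Delbourgo2002, Theorem (A), (B) (p. 40), Hypothesis (p. 39)]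
[cite: Kato2004Asterisque, Thm. 17.4 (3) (p. 273)] [cite: BCDTJAMS2001, Theorem A] [cite: Miller2011LMS, §1 and Def. 1.1] -/
theorem ClassX4Gord.bsdp_three_rankZero_of_katoHalf_of_coeffCert_of_pow_le_card_selmerGroup_of_nonAnomalous_noDel98_entireFree
    [Fact (Nat.Prime 3)]
    (hK : Wuthrich2014.kato_halfEigenCharIdeal_dvd_cyclotomicPrime_of_surjective)
    (hDel3 : Delbourgo2002.mainTheorem_three)
    (hGZK : rank_eq_analyticRank_of_analyticRank_le_one)
    (hmodD : nonempty_modularParametrizationData)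
    (h414 : Greenberg1999.prop414_noFiniteSubmodule_of_not_dvd_torsionOrder)
    (hX : ClassX4Gord W 3) (hcm : ¬ W.HasCM) (hsurj : Surj W 3) (hr : W.analyticRank = 0)
    {b : ℕ} (hcert : BranchUnitCoeffAt W 3 b) (hSel : 3 ^ b ≤ Nat.card (selmerGroup W (3 : ℤ)))
    (hna : Delbourgo2002.ReductionNonAnomalous W 3) : BSDp W 3 :=
  ClassX4Gord.bsdp_three_rankZero_of_katoHalf_of_coeffCert_of_pow_le_card_selmerGroup_of_nonAnomalous_noDel98
    hK hDel3 hGZK (hasEntireLFunction_rat_of_nonempty_modularParametrizationData hmodD) hmodD h414 hX hcm hsurj hr hcert hSel hna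

/-- **(E) ROUTE 2's Gord_e2 END at `p ≥ 5` (p10 GEN 2, `CongruentPartnerMainConjectureGordBSD.lean:144`),
modularity binder AND the tree-proved Pal binder OUT**: X4♯(G-ord) ∩ `I₀*` ∩ {`ρ̄` onto}, `p ≥ 5`,
`r_an = 0`, non-CM, non-anomalous: `BSD(E,p)` ⟸ ONE unit coefficient at index `b` + the budget —
`…_of_budget_of_nonAnomalous` with binder diff EXACTLY {`hmod`, `hPal`} ↦ ∅ (`hPal` fed by
`pal2012_thm32_sqrt_mul_realPeriodRat_twist_eq_of_prime_one_mod_four_holds`): named facts 7 ↦ 5 =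
{hK, hDel98, hDel, hGZK, hmodD}. [cite: Delbourgo2002, Theorem (A), (B) (p. 40)]
[cite: Kato2004Asterisque, Thm. 17.4 (3) (p. 273)] [cite: Delbourgo1998, Prop. 4 (p. 144)] [cite: Pal2012, Thm. 3.2]
[cite: BCDTJAMS2001, Theorem A] [cite: Miller2011LMS, §1 and Def. 1.1] -/
theorem ClassX4Gord.bsdp_rankZero_of_katoHalf_of_coeffCert_of_budget_of_nonAnomalous_entireFree
    (hK : Wuthrich2014.kato_halfEigenCharIdeal_dvd_cyclotomicPrime_of_surjective)
    (hDel98 : Delbourgo1998.prop4_rankZero_pow_dvd_constantCoeff) (hDel : Delbourgo2002.mainTheorem)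
    (hGZK : rank_eq_analyticRank_of_analyticRank_le_one)
    (hmodD : nonempty_modularParametrizationData)
    (hX : ClassX4Gord W p) (hcm : ¬ W.HasCM) (hp5 : 5 ≤ p) (he : semistabilityIndex W p = 2)
    (hsurj : Surj W p) (hr : W.analyticRank = 0)
    {b : ℕ} (hcert : BranchUnitCoeffAt W p b) (hbud : BudgetLeLambdaAt p W b)
    (hna : Delbourgo2002.ReductionNonAnomalous W p) : BSDp W p :=
  ClassX4Gord.bsdp_rankZero_of_katoHalf_of_coeffCert_of_budget_of_nonAnomalous hK
    pal2012_thm32_sqrt_mul_realPeriodRat_twist_eq_of_prime_one_mod_four_holds hDel98 hDel hGZK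
    (hasEntireLFunction_rat_of_nonempty_modularParametrizationData hmodD) hmodD hX hcm hp5 he hsurj hr hcert hbud hna

/-- **(E′) the SAME row's END after T-DEL98X-5 (`…_of_nonAnomalous_noDel98`, the Gord_e2 END of record
at `p ≥ 5` once p325814 landed), modularity binder OUT**: binder diff EXACTLY {`hmod`} ↦ ∅ against it —
named facts {hK, hDel (A175), hGZK, hmodD} = 4 (r2 GEN 45 2026-08-22T10:20Z (3)(E): this is the twin
that moves the row 5 ↦ 4). [cite: Delbourgo2002, Theorem (A), (B) (p. 40)]
[cite: Kato2004Asterisque, Thm. 17.4 (3) (p. 273)] [cite: BCDTJAMS2001, Theorem A] [cite: Miller2011LMS, §1 and Def. 1.1] -/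
theorem ClassX4Gord.bsdp_rankZero_of_katoHalf_of_coeffCert_of_budget_of_nonAnomalous_noDel98_entireFree
    (hK : Wuthrich2014.kato_halfEigenCharIdeal_dvd_cyclotomicPrime_of_surjective)
    (hDel : Delbourgo2002.mainTheorem)
    (hGZK : rank_eq_analyticRank_of_analyticRank_le_one)
    (hmodD : nonempty_modularParametrizationData)
    (hX : ClassX4Gord W p) (hcm : ¬ W.HasCM) (hp5 : 5 ≤ p) (he : semistabilityIndex W p = 2)
    (hsurj : Surj W p) (hr : W.analyticRank = 0)
    {b : ℕ} (hcert : BranchUnitCoeffAt W p b) (hbud : BudgetLeLambdaAt p W b)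
    (hna : Delbourgo2002.ReductionNonAnomalous W p) : BSDp W p :=
  ClassX4Gord.bsdp_rankZero_of_katoHalf_of_coeffCert_of_budget_of_nonAnomalous_noDel98 hK hDel hGZK
    (hasEntireLFunction_rat_of_nonempty_modularParametrizationData hmodD) hmodD hX hcm hp5 he hsurj hr
    hcert hbud hna

end Gord

/-! ### §3 (F), (G): cc-typer-2's N10 CLASS ENDs and the X3 @ 3 `W = 2` descent END -/

section N10

variable (W : WeierstrassCurve ℚ) [W.IsElliptic] [W.IsGloballyMinimal] (p : ℕ) [hp : Fact p.Prime]

/-- **(F1) N10(M) ⟹ `BSD(E,p)` on X4(M) ∧ `r_an = 0` ∧ surj(p), every odd `p` — cc-typer-2's N10 CLASS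
END `N10.bsdp_rankZero_classX4M_of_lowerHalfM_of_surj` with the modularity binder AND the tree-proved
Wuthrich-Lemma-20 binder OUT** (binder diff EXACTLY {`hmod`, `hL20`} ↦ ∅, NOTHING added; the upper
half is n1011-p14's `hL20`-free `ClassX4M.bsdp_rankZero_of_surj_of_lower_noL20`): named facts 6 ↦ 4 =
{hDel, hGZK, hmodD, hKato}; the typed conjecture `h : N10.LowerHalfM` unchanged.
[cite: Delbourgo1998, Prop. 4 (p. 144)] [cite: Kato2004Asterisque, Thm. 17.4 (3) (p. 273)]
[cite: Wuthrich2014, Cor. 19 (p. 398)] [cite: BCDTJAMS2001, Theorem A] [cite: Miller2011LMS, §1 and Def. 1.1] -/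
theorem N10.bsdp_rankZero_classX4M_of_lowerHalfM_of_surj_entireFree (h : N10.LowerHalfM)
    (hDel : Delbourgo1998.prop4_rankZero_pow_dvd_constantCoeff)
    (hGZK : rank_eq_analyticRank_of_analyticRank_le_one)
    (hmodD : nonempty_modularParametrizationData)
    (hKato : Wuthrich2014.kato_halfEigenCharIdeal_dvd_cyclotomicPrime_of_surjective)
    (hX : AdditivePotMult.ClassX4M W p) (hr : W.analyticRank = 0) (hsurj : Surj W p) : BSDp W p :=
  AdditivePotMult.ClassX4M.bsdp_rankZero_of_surj_of_lower_noL20 hDel hGZK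
    (hasEntireLFunction_rat_of_nonempty_modularParametrizationData hmodD) hmodD hKato hX hr hsurj
    (h W p hr ((N10.cellM_iff_classX3M_or_classX4M W p).mpr (Or.inr hX)))

/-- **(F2) N10(G-ord, `e = 2`) ⟹ `BSD(E,p)` on X4♯(G-ord) ∩ `I₀*` ∧ `r_an = 0` ∧ surj(p)** — cc-typer-2's
`N10.bsdp_rankZero_classX4GordTwo_of_lowerHalfGordTwo_of_surj` with `{hmod}` ↦ ∅: {hK, hDel, hGZK, hmodD}
= 4. [cite: Kato2004Asterisque, Thm. 17.4 (3) (p. 273)] [cite: Delbourgo1998, Prop. 4 (p. 144)]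
[cite: BCDTJAMS2001, Theorem A] [cite: Miller2011LMS, §1 and Def. 1.1] -/
theorem N10.bsdp_rankZero_classX4GordTwo_of_lowerHalfGordTwo_of_surj_entireFree (h : N10.LowerHalfGordTwo)
    (hK : Kato2004.charIdeal_dvd_padicLFunctionBranch_component_of_surjective)
    (hDel : Delbourgo1998.prop4_rankZero_pow_dvd_constantCoeff)
    (hGZK : rank_eq_analyticRank_of_analyticRank_le_one)
    (hmodD : nonempty_modularParametrizationData)
    (hX : ClassX4Gord W p) (he : semistabilityIndex W p = 2) (hr : W.analyticRank = 0)
    (hsurj : Surj W p) (hram3 : p = 3 → Ram W p) : BSDp W p :=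
  N10.bsdp_rankZero_classX4GordTwo_of_lowerHalfGordTwo_of_surj W p h hK hDel hGZK
    (hasEntireLFunction_rat_of_nonempty_modularParametrizationData hmodD) hmodD hX he hr hsurj hram3

/-- **(F3) N10 ⟹ `BSD(E,p)` on the whole COVERED LOCUS of X4 ∧ `r_an = 0` ∧ surj(p) ∧ potentially
ordinary, every odd `p`** — cc-typer-2's `N10.bsdp_rankZero_classX4_covered_of_lowerHalf` with binder diff
EXACTLY {`hmod`, `hL20`} ↦ ∅ (additive-p4 / p14's `hL20`-free chain `X4RankZero.bsdp_of_facts_of_lower_noL20`):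
named facts 7 ↦ 5 = {hKatoS, hDel, hGZK, hmodD, hKatoχ}; the A161 flag of the original docstring
stands verbatim (`hKatoS` is carried as an explicit hypothesis, never a `_holds`).
[cite: Kato2004Asterisque, Thm. 14.5 (3) (p. 236), Prop. 14.16 (2) (p. 244), Thm. 17.4 (3) (p. 273)]
[cite: Delbourgo1998, Prop. 4 (p. 144)] [cite: BCDTJAMS2001, Theorem A] [cite: Miller2011LMS, §1 and Def. 1.1] -/
theorem N10.bsdp_rankZero_classX4_covered_of_lowerHalf_entireFree (h : N10.LowerHalf)
    (hKatoS : Kato2004.rankZero_padicValNat_sha_le_sub_localTamagawa_of_additive_potGood_of_imageContainsSL2)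
    (hDel : Delbourgo1998.prop4_rankZero_pow_dvd_constantCoeff)
    (hGZK : rank_eq_analyticRank_of_analyticRank_le_one)
    (hmodD : nonempty_modularParametrizationData)
    (hKatoχ : Wuthrich2014.kato_halfEigenCharIdeal_dvd_cyclotomicPrime_of_surjective)
    (hr : W.analyticRank = 0) (hX : ClassX4 W p) (hsurj : Surj W p)
    (hord : PotMult W p ∨ TypeGOrd W p)
    (hcov : padicValRat p W.j < 0 ∨
      ((∀ n : ℕ, W.HasSurjectiveModNGaloisRep (p ^ n : ℕ)) ∧
        padicValNat p W.tamagawaProduct =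
          padicValNat p ((W.baseChange ℚ_[p]).localTamagawaNumber ℤ_[p]) ∧
        ∃ (N : ℕ) (_ : NeZero N) (D : ModularParametrizationData W N), ¬ (p : ℤ) ∣ D.maninConstant)) :
    BSDp W p :=
  X4RankZero.bsdp_of_facts_of_lower_noL20 W p hKatoS hDel hGZK (hasEntireLFunction_rat_of_nonempty_modularParametrizationData hmodD)
    hmodD hKatoχ hr hX hsurj hcov (h W p hr ⟨hX.1, hX.2.1, hord⟩)

/-- **(F4) N10(X3) ⟹ `BSD(E,p)` on X3 ∧ `r_an = 0` ∧ semistable twist, every odd `p`, over ONE reading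
of Wuthrich Thm. 16 and WITHOUT the modularity binder** — T-WU16X's
`N10.bsdp_rankZero_classX3_of_lowerHalf_of_subSemistableTwist_of_thm16` with `{hmod}` ↦ ∅:
{hDel, hGZK, hmodD, hW16} = 4. [cite: Delbourgo1998, Prop. 4 (p. 144)] [cite: Wuthrich2014, Thm. 16 (p. 397)]
[cite: BCDTJAMS2001, Theorem A] [cite: Miller2011LMS, §1 and Def. 1.1] -/
theorem N10.bsdp_rankZero_classX3_of_lowerHalf_of_subSemistableTwist_of_thm16_entireFree
    (h : N10.LowerHalf) (hDel : Delbourgo1998.prop4_rankZero_pow_dvd_constantCoeff)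
    (hGZK : rank_eq_analyticRank_of_analyticRank_le_one)
    (hmodD : nonempty_modularParametrizationData)
    (hW16 : Wuthrich2014.thm16_halfEigenCharIdeal_dvd_cyclotomicPrime)
    (hp2 : p ≠ 2) (hX : ClassX3 W p) (hr : W.analyticRank = 0) (hS : SubSemistableTwist W p) :
    BSDp W p :=
  N10.bsdp_rankZero_classX3_of_lowerHalf_of_subSemistableTwist_of_thm16 W p h hDel hGZK
    (hasEntireLFunction_rat_of_nonempty_modularParametrizationData hmodD) hmodD hW16 hp2 hX hr hS

/-- **(G) the X3 @ 3 `W = 2` descent END (additive-p4 V25b; r2 §II.23), over ONE reading of Wuthrich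
Thm. 16 and WITHOUT the modularity binder** — T-WU16X's `…_of_casselsTate_of_selmerGroup_ne_bot_of_thm16`
with `{hmod}` ↦ ∅: {hDel, hGZK, hmodD, hW16, hCT} = 5. [cite: Delbourgo1998, Prop. 4 (p. 144)]
[cite: Wuthrich2014, Thm. 16 (p. 397)] [cite: SilvermanAEC2009, Thm. X.4.2 and Thm. X.4.14]
[cite: BCDTJAMS2001, Theorem A] [cite: Miller2011LMS, §1 and Def. 1.1] -/
theorem ClassX3.bsdp_rankZero_of_subSemistableTwist_of_casselsTate_of_selmerGroup_ne_bot_of_thm16_entireFree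
    (hDel : Delbourgo1998.prop4_rankZero_pow_dvd_constantCoeff)
    (hGZK : rank_eq_analyticRank_of_analyticRank_le_one)
    (hmodD : nonempty_modularParametrizationData)
    (hW16 : Wuthrich2014.thm16_halfEigenCharIdeal_dvd_cyclotomicPrime)
    (hCT : exists_casselsTate_pairing (K := ℚ))
    (hp2 : p ≠ 2) (hX : ClassX3 W p) (hr : W.analyticRank = 0) (hS : SubSemistableTwist W p)
    (htors : ¬ p ∣ W.torsionOrder)
    {q : ℚ} (hq : shaAn W = (q : ℂ)) (hv : padicValRat p q ≤ 2)
    (hSel : W.selmerGroup (p : ℤ) ≠ ⊥) : BSDp W p :=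
  ClassX3.bsdp_rankZero_of_subSemistableTwist_of_casselsTate_of_selmerGroup_ne_bot_of_thm16 W p hDel hGZK
    (hasEntireLFunction_rat_of_nonempty_modularParametrizationData hmodD) hmodD hW16 hCT hp2 hX hr hS htors hq hv hSel

end N10

end Summit.BirchSwinnertonDyer.Rank1Residual.Additive

end
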